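import Mathlib.Analysis.Calculus.InverseFunctionTheorem.FDeriv
import Literature.Geometry.Lorentzian.KerrSchild
import HarnessLib

/-!
# Crux `GapExhaustion` (stmt-FinalStateConjecture-10808), line `photon-shell-pseudoconvexity`:
# stub (N-1) `stub_lorentzNormalisation` — Lorentzian normalisation of a near-Minkowski form

Route `BartnikGapSettling`; helper (`--supports stmt-FinalStateConjecture-10808`) landing the
registered glue stub (N-1) of the reduction of the outward Killing-extension sweep (S5 of the node
`EternalSilentNearKerrIsKerr`) to the Ionescu–Klainerman local extension theorem in chart form,
which is typed with the normalisation `G p = η` *exactly* at the centre of the ball. At a point of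
a near-Kerr chart the pulled-back metric read in the Kerr–Schild frame is a symmetric bilinear
form `S` on `E4` close to `η = Minkowski.bilin` but not equal to it; this file supplies the
near-identity linear change of frame: one universal `δN > 0` such that every symmetric `S` with
`‖S − η‖ ≤ δN` admits `C : E4 ≃L[ℝ] E4` with `S (C v) (C w) = η v w`, `‖C‖ ≤ 2`, `‖C⁻¹‖ ≤ 2`.
This is the quantitative germ at `A = η` of Hirsch's parametric diagonalisation lemma (Hirsch,
*Differential Topology* (1976), Ch. 6 §1, Lemma, p. 145: near a nondegenerate symmetric `A`
there is `P` with `P(A) = I` and `ᵗQ B Q = A` for `Q = P(B)`); pure finite-dimensional analysis.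

Proof (inverse function theorem on the space of bilinear forms; no auxiliary definitions). With
an index-raising map `η♯ : (E4 →L ℝ) →L E4` (`η (η♯ ω) w = ω w`, `lorentzNorm_exists_sharp`) and
`♯T v := η♯ (T v)`, the map `F T := η + T + ¼ η(♯T ·, ♯T ·)` has strict derivative `id` at `0`
(the last term is a bounded bilinear map of `(♯T, ♯T)`), so it maps `𝓝 0` onto `𝓝 η`
(`HasStrictFDerivAt.map_nhds_eq_of_equiv`); hence some `ball η ε ⊆ F '' ball 0 r` with
`‖♯‖ r ≤ 1`, and `δN := ε / 2`. For `S = F T` symmetric, the antisymmetric part of `F T` is that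
of `T`, so `T` is symmetric, and then `F T = η(C₀ ·, C₀ ·)` with `C₀ := 1 + ½ ♯T`, `‖½ ♯T‖ ≤ ½`;
thus `‖v‖ ≤ 2 ‖C₀ v‖ ≤ 4 ‖v‖`, `C₀` is injective hence (finite dimension) invertible with
`‖C₀⁻¹‖ ≤ 2`, `‖C₀‖ ≤ 2`, and `C := C₀⁻¹` satisfies `S (C v) (C w) = η (C₀ C v) (C₀ C w) = η v w`.
The same device proves Hirsch's lemma in `Literature/Topology/FourManifolds/
MorseLemmaDiagonalization.lean` (general `V`, smooth dependence, no norm bounds); it is not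
imported here to keep the Lorentzian cone free of the four-manifold files.
-/

noncomputable section

-- instance search through the nested operator types `E4 →L[ℝ] E4 →L[ℝ] ℝ`
set_option maxSynthPendingDepth 3

-- D-0017: single-problem summit, `Summit.<S>.<S>.…` by design (lakefile `weak.linter.dupNamespace`)
set_option linter.dupNamespace false

namespace Summit.FinalStateConjecture.FinalStateConjecture.Theorems

open Set Filter Metric Function Literature.Geometry.Lorentzian
open scoped Topology

/-- **Index raising.** There is a continuous linear map `η♯ : (E4 →L[ℝ] ℝ) →L[ℝ] E4` with
`η (η♯ ω, w) = ω w` for all `ω`, `w`, namely `η♯ ω = (−ω(∂₀), ω(∂₁), ω(∂₂), ω(∂₃))` (the metric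
equivalence `♯` of O'Neill 1983, Ch. 3, p. 60, for `ℝ⁴₁`). [folklore] -/
private theorem lorentzNorm_exists_sharp :
    ∃ sh : (E4 →L[ℝ] ℝ) →L[ℝ] E4, ∀ (ω : E4 →L[ℝ] ℝ) (w : E4),
      Minkowski.bilin (sh ω) w = ω w := by
  set sh : (E4 →L[ℝ] ℝ) →L[ℝ] E4 :=
    ((EuclideanSpace.equiv (Fin 4) ℝ).symm : (Fin 4 → ℝ) →L[ℝ] E4).comp
      (ContinuousLinearMap.pi
        (Fin.cons (-ContinuousLinearMap.apply ℝ ℝ (E4.basisVector 0))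
          (fun i : Fin 3 ↦ ContinuousLinearMap.apply ℝ ℝ (E4.basisVector i.succ)) :
            Fin 4 → (E4 →L[ℝ] ℝ) →L[ℝ] ℝ)) with hsh
  have h0 : ∀ ω : E4 →L[ℝ] ℝ, sh ω 0 = -ω (E4.basisVector 0) := fun ω ↦ by
    simp [hsh, PiLp.toLp_apply]
  have hsucc : ∀ (ω : E4 →L[ℝ] ℝ) (i : Fin 3), sh ω i.succ = ω (E4.basisVector i.succ) :=
    fun ω i ↦ by simp [hsh, PiLp.toLp_apply]
  refine ⟨sh, fun ω w ↦ ?_⟩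
  have h := (EuclideanSpace.basisFun (Fin 4) ℝ).sum_repr w
  simp only [EuclideanSpace.basisFun_repr, EuclideanSpace.basisFun_apply] at h
  conv_rhs => rw [← h]
  rw [map_sum, Fin.sum_univ_succ, Minkowski.bilin_apply, h0]
  simp only [hsucc, map_smul, smul_eq_mul, Fin.sum_univ_three]
  ring

/-- `(A, B) ↦ β(A ·, B ·)` is a bounded bilinear map of the pair of endomorphisms `(A, B)`
(the `E4` instance of `ContinuousLinearMap.bilinearComp` being bilinear and bounded by
`‖β‖ ‖A‖ ‖B‖`). [folklore] -/
private theorem lorentzNorm_isBoundedBilinearMap (β : E4 →L[ℝ] E4 →L[ℝ] ℝ) :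
    IsBoundedBilinearMap ℝ
      (fun p : (E4 →L[ℝ] E4) × (E4 →L[ℝ] E4) ↦ β.bilinearComp p.1 p.2) where
  add_left A₁ A₂ B := by ext v w; simp
  smul_left c A B := by ext v w; simp
  add_right A B₁ B₂ := by ext v w; simp
  smul_right c A B := by ext v w; simp
  bound := by
    refine ⟨‖β‖ + 1, by positivity, fun A B ↦ ?_⟩
    show ‖β.bilinearComp A B‖ ≤ (‖β‖ + 1) * ‖A‖ * ‖B‖
    refine ContinuousLinearMap.opNorm_le_bound₂ _ (by positivity) fun v w ↦ ?_
    calc ‖β.bilinearComp A B v w‖ = ‖β (A v) (B w)‖ := rfl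
      _ ≤ ‖β‖ * ‖A v‖ * ‖B w‖ := β.le_opNorm₂ _ _
      _ ≤ (‖β‖ + 1) * (‖A‖ * ‖v‖) * (‖B‖ * ‖w‖) := by
        gcongr
        · linarith
        · exact A.le_opNorm v
        · exact B.le_opNorm w
      _ = (‖β‖ + 1) * ‖A‖ * ‖B‖ * ‖v‖ * ‖w‖ := by ring

/-- For every continuous linear `L` from bilinear forms to endomorphisms, the map
`F T := η + T + ¼ η(L T ·, L T ·)` has strict Fréchet derivative `id` at `0` (the quadratic term
is a bounded bilinear map composed with the diagonal `T ↦ (L T, L T)`, with derivative `0` at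
`0`). [folklore] -/
private theorem lorentzNorm_hasStrictFDerivAt
    (L : (E4 →L[ℝ] E4 →L[ℝ] ℝ) →L[ℝ] (E4 →L[ℝ] E4)) :
    HasStrictFDerivAt
      (fun T : E4 →L[ℝ] E4 →L[ℝ] ℝ ↦
        Minkowski.bilin + T + (1 / 4 : ℝ) • Minkowski.bilin.bilinearComp (L T) (L T))
      (ContinuousLinearEquiv.refl ℝ (E4 →L[ℝ] E4 →L[ℝ] ℝ) :
        (E4 →L[ℝ] E4 →L[ℝ] ℝ) →L[ℝ] (E4 →L[ℝ] E4 →L[ℝ] ℝ)) 0 := by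
  have hQ := lorentzNorm_isBoundedBilinearMap Minkowski.bilin
  have h2 : HasStrictFDerivAt (fun T ↦ (L T, L T)) (L.prod L) (0 : E4 →L[ℝ] E4 →L[ℝ] ℝ) :=
    L.hasStrictFDerivAt.prodMk L.hasStrictFDerivAt
  have h3 : HasStrictFDerivAt (fun T ↦ Minkowski.bilin.bilinearComp (L T) (L T))
      ((hQ.deriv (L 0, L 0)).comp (L.prod L)) 0 :=
    (hQ.hasStrictFDerivAt (L 0, L 0)).comp 0 h2
  have h4 := ((hasStrictFDerivAt_const (𝕜 := ℝ) Minkowski.bilin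
    (0 : E4 →L[ℝ] E4 →L[ℝ] ℝ)).add (hasStrictFDerivAt_id (𝕜 := ℝ) (0 : E4 →L[ℝ] E4 →L[ℝ] ℝ))).add
    (h3.const_smul (1 / 4 : ℝ))
  refine h4.congr_fderiv ?_
  ext T v w
  simp [hQ.deriv_apply]

/-- Values of `F`: `F T v w = η v w + T v w + ¼ η (L T v) (L T w)`. [folklore] -/
private theorem lorentzNorm_apply (L : (E4 →L[ℝ] E4 →L[ℝ] ℝ) →L[ℝ] (E4 →L[ℝ] E4))
    (T : E4 →L[ℝ] E4 →L[ℝ] ℝ) (v w : E4) :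
    (Minkowski.bilin + T + (1 / 4 : ℝ) • Minkowski.bilin.bilinearComp (L T) (L T)) v w =
      Minkowski.bilin v w + T v w + 1 / 4 * Minkowski.bilin (L T v) (L T w) := by
  simp only [add_apply, smul_apply, ContinuousLinearMap.bilinearComp_apply, smul_eq_mul]

/-- The antisymmetric part of `F T` is that of `T`: if `F T` is symmetric, so is `T`.
[folklore] -/
private theorem lorentzNorm_symm_of_symm (L : (E4 →L[ℝ] E4 →L[ℝ] ℝ) →L[ℝ] (E4 →L[ℝ] E4))
    (T : E4 →L[ℝ] E4 →L[ℝ] ℝ)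
    (hFT : ∀ v w : E4,
      (Minkowski.bilin + T + (1 / 4 : ℝ) • Minkowski.bilin.bilinearComp (L T) (L T)) v w =
      (Minkowski.bilin + T + (1 / 4 : ℝ) • Minkowski.bilin.bilinearComp (L T) (L T)) w v)
    (v w : E4) : T v w = T w v := by
  have h := hFT v w
  rw [lorentzNorm_apply, lorentzNorm_apply, Minkowski.bilin_symm w v,
    Minkowski.bilin_symm (L T w)] at h
  linarith

/-- If `η (L T v) w = T v w` (i.e. `L T = ♯T`) and `T` is symmetric, then
`F T = η(C₀ ·, C₀ ·)` with `C₀ = 1 + ½ L T`. [folklore] -/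
private theorem lorentzNorm_eq_of_symm (L : (E4 →L[ℝ] E4 →L[ℝ] ℝ) →L[ℝ] (E4 →L[ℝ] E4))
    (hL : ∀ (T : E4 →L[ℝ] E4 →L[ℝ] ℝ) (v w : E4), Minkowski.bilin (L T v) w = T v w)
    (T : E4 →L[ℝ] E4 →L[ℝ] ℝ) (hT : ∀ v w : E4, T v w = T w v) (v w : E4) :
    (Minkowski.bilin + T + (1 / 4 : ℝ) • Minkowski.bilin.bilinearComp (L T) (L T)) v w =
      Minkowski.bilin ((1 + (1 / 2 : ℝ) • L T) v) ((1 + (1 / 2 : ℝ) • L T) w) := by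
  have e1 : Minkowski.bilin (L T v) w = T v w := hL T v w
  have e2 : Minkowski.bilin v (L T w) = T v w := by rw [Minkowski.bilin_symm, hL, hT]
  rw [lorentzNorm_apply]
  simp only [add_apply, one_apply_eq_self, smul_apply, map_add, map_smul, smul_eq_mul]
  rw [e1, e2]
  ring

/-- **(N-1) Lorentzian normalisation of a near-Minkowski symmetric form.** There is `δN > 0`
such that every symmetric bilinear form `S` on `E4` with `‖S − η‖ ≤ δN` is congruent to
`η = Minkowski.bilin` by a linear change of frame `C : E4 ≃L[ℝ] E4`, `S (C v) (C w) = η v w`,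
with `‖C‖ ≤ 2` and `‖C⁻¹‖ ≤ 2`: the quantitative germ at `A = η` of Hirsch's parametric
diagonalisation lemma (Hirsch, *Differential Topology* (1976), Ch. 6 §1, Lemma, p. 145), proved
here by the inverse function theorem. [cite: HirschDT1976, Ch. 6 §1, Lemma (p. 145)] -/
theorem stub_lorentzNormalisation :
    ∃ δN : ℝ, 0 < δN ∧ ∀ S : E4 →L[ℝ] E4 →L[ℝ] ℝ, (∀ v w : E4, S v w = S w v) →
      ‖S - Minkowski.bilin‖ ≤ δN →
      ∃ C : E4 ≃L[ℝ] E4, (∀ v w : E4, S (C v) (C w) = Minkowski.bilin v w) ∧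
        ‖(C : E4 →L[ℝ] E4)‖ ≤ 2 ∧ ‖(C.symm : E4 →L[ℝ] E4)‖ ≤ 2 := by
  -- index raising `η♯`, `♯T := η♯ ∘ T`, and the normalising map `F`
  obtain ⟨sh, hsh⟩ := lorentzNorm_exists_sharp
  obtain ⟨L, hL⟩ : ∃ L : (E4 →L[ℝ] E4 →L[ℝ] ℝ) →L[ℝ] (E4 →L[ℝ] E4),
      ∀ (T : E4 →L[ℝ] E4 →L[ℝ] ℝ) (v w : E4), Minkowski.bilin (L T v) w = T v w :=
    ⟨ContinuousLinearMap.compL ℝ E4 (E4 →L[ℝ] ℝ) E4 sh, fun T v w ↦ by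
      rw [ContinuousLinearMap.compL_apply]; exact hsh (T v) w⟩
  obtain ⟨F, hF⟩ : ∃ F : (E4 →L[ℝ] E4 →L[ℝ] ℝ) → (E4 →L[ℝ] E4 →L[ℝ] ℝ), F = fun T ↦
      Minkowski.bilin + T + (1 / 4 : ℝ) • Minkowski.bilin.bilinearComp (L T) (L T) :=
    ⟨_, rfl⟩
  have hFd := lorentzNorm_hasStrictFDerivAt L
  rw [← hF] at hFd
  -- a radius on which `‖½ ♯T‖ ≤ ½`
  obtain ⟨r, hr0, hr⟩ : ∃ r : ℝ, 0 < r ∧ ‖L‖ * r ≤ 1 :=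
    ⟨1 / (‖L‖ + 1), by positivity, by rw [mul_one_div, div_le_one (by positivity)]; linarith⟩
  -- `F '' ball 0 r` is a neighbourhood of `η = F 0` (inverse function theorem)
  have hF0 : F 0 = Minkowski.bilin := by rw [hF]; simp
  have himg : F '' ball 0 r ∈ 𝓝 Minkowski.bilin := by
    rw [← hF0, ← hFd.map_nhds_eq_of_equiv]
    exact image_mem_map (ball_mem_nhds 0 hr0)
  obtain ⟨ε, hε, hball⟩ := Metric.mem_nhds_iff.1 himg
  refine ⟨ε / 2, half_pos hε, fun S hS hSη ↦ ?_⟩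
  obtain ⟨T, hT, hTS⟩ : S ∈ F '' ball 0 r := hball (by rw [mem_ball, dist_eq_norm]; linarith)
  rw [mem_ball, dist_zero_right] at hT
  -- `T` is symmetric, so `S = F T = η(C₀ ·, C₀ ·)` with `C₀ = 1 + N`, `N = ½ ♯T`
  have hTsymm : ∀ v w : E4, T v w = T w v :=
    lorentzNorm_symm_of_symm L T fun v w ↦ by
      have h := hS v w
      rw [← hTS, hF] at h
      exact h
  obtain ⟨N, hN⟩ : ∃ N : E4 →L[ℝ] E4, N = (1 / 2 : ℝ) • L T := ⟨_, rfl⟩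
  obtain ⟨C₀, hC₀⟩ : ∃ C₀ : E4 →L[ℝ] E4, C₀ = 1 + N := ⟨_, rfl⟩
  have hSC : ∀ v w : E4, S v w = Minkowski.bilin (C₀ v) (C₀ w) := fun v w ↦ by
    rw [← hTS, hF, hC₀, hN]
    exact lorentzNorm_eq_of_symm L hL T hTsymm v w
  -- `‖N‖ ≤ ½`, hence `‖v‖ ≤ 2 ‖C₀ v‖` and `‖C₀ v‖ ≤ 2 ‖v‖`
  have hNn : ‖N‖ ≤ 1 / 2 := by
    have h1 : ‖L T‖ ≤ 1 :=
      (L.le_opNorm T).trans ((mul_le_mul_of_nonneg_left hT.le (norm_nonneg _)).trans hr)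
    rw [hN, norm_smul, Real.norm_of_nonneg (by norm_num : (0 : ℝ) ≤ 1 / 2)]
    linarith
  have hNv : ∀ v : E4, ‖N v‖ ≤ 1 / 2 * ‖v‖ := fun v ↦
    (N.le_opNorm v).trans (mul_le_mul_of_nonneg_right hNn (norm_nonneg _))
  have hlow : ∀ v : E4, ‖v‖ ≤ 2 * ‖C₀ v‖ := fun v ↦ by
    have h1 : ‖v‖ ≤ ‖C₀ v‖ + ‖N v‖ :=
      calc ‖v‖ = ‖C₀ v - N v‖ := by rw [hC₀]; simp
        _ ≤ ‖C₀ v‖ + ‖N v‖ := norm_sub_le _ _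
    linarith [hNv v]
  have hup : ∀ v : E4, ‖C₀ v‖ ≤ 2 * ‖v‖ := fun v ↦
    calc ‖C₀ v‖ = ‖v + N v‖ := by rw [hC₀]; simp
      _ ≤ ‖v‖ + ‖N v‖ := norm_add_le _ _
      _ ≤ 2 * ‖v‖ := by linarith [hNv v, norm_nonneg v]
  -- `C₀` is injective, hence invertible (finite dimension); `C := C₀⁻¹`
  have hinj : Injective C₀ := fun v₁ v₂ h ↦ by
    have h1 := hlow (v₁ - v₂)
    rw [map_sub, h, sub_self, norm_zero, mul_zero] at h1
    exact sub_eq_zero.1 (norm_le_zero_iff.1 h1)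
  let C₀e : E4 ≃L[ℝ] E4 :=
    (LinearEquiv.ofInjectiveEndo (C₀ : E4 →ₗ[ℝ] E4) hinj).toContinuousLinearEquiv
  have hC₀e : ∀ v : E4, C₀e v = C₀ v := fun v ↦ rfl
  refine ⟨C₀e.symm, fun v w ↦ ?_, ?_, ?_⟩
  · rw [hSC, ← hC₀e (C₀e.symm v), ← hC₀e (C₀e.symm w), C₀e.apply_symm_apply,
      C₀e.apply_symm_apply]
  · refine ContinuousLinearMap.opNorm_le_bound _ (by norm_num) fun v ↦ ?_
    have h1 := hlow (C₀e.symm v)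
    rw [← hC₀e (C₀e.symm v), C₀e.apply_symm_apply] at h1
    exact h1
  · refine ContinuousLinearMap.opNorm_le_bound _ (by norm_num) fun v ↦ ?_
    rw [ContinuousLinearEquiv.symm_symm]
    exact hup v

end Summit.FinalStateConjecture.FinalStateConjecture.Theorems

end
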